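import Summits.HodgeConjecture.HodgeConjecture.Theorems.F0P3bU21Restriction
import HarnessLib

/-!
# FLOOR-0 P3b «ENGINE local packets», line `F0_LocalAPackets` — KOVAČEVIĆ COORDINATES of `z₀`, the `𝔭`-basis and `𝔨`
# under the honest `𝔲(2,1)`-action `kovLie ρ` (brick (w4g))

Cell hodgecm-mathlib (D-0151), FLOOR 0, crux item H413 = stmt-HodgeConjecture-24833; sub-line `Cruxes/H413/Lines/F0_LocalAPackets.lean`
(F0P3b-plan (g5), ed. 3 → ed. 4 §1K).  Brick (w4g) of F0P3b-plan (g5) 2026-08-31T03:39:06Z; PROOF lane (theorems only: no `def`, no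
`sorry`, no instance declaration, no notation, no named fact); author B-p08 (g17).  Imports ★ `Theorems.F0P3bU21Restriction` (+ HarnessLib)
— not on the R2 reverse cone; NEVER the Lines module.

Content.  For a GENERIC `𝔤𝔩(3, ℂ)`-action `ρ` and the honest `𝔲(2,1)`-action `kovLie ρ X = ρ (reindex X)` (★ `kovLie_apply`, the
`β`-block LAST under `Fin 2 ⊕ Fin 1 ≃ Fin 3`), the images of the named elements that W4 (★ `IsLadderValueMap` clauses (2)(4)(5)(6))
quantifies over, in Kovačević's coordinates `E_{ij} = Matrix.single i j 1`:
* §1 the reindex dictionary (`e⁻¹ 0 = inl 0`, `e⁻¹ 1 = inl 1`, `e⁻¹ 2 = inr 0`): `reindex z₀ = i (E₀₀ + E₁₁)` (★ `coe_upqZ0 = [[i·1, 0], [0, 0]]`),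
  `reindex X_{c E_(a,b)} = c • E_{a 2} + c̄ • E_{2 a}` (★ `coe_upqUnit`), `reindex [[A, 0], [0, D]] = Σ A a a′ • E_{a a′} + D₀₀ • E₂₂`;
* §2 **`kovLie ρ z₀ = i · (ρ E₀₀ + ρ E₁₁)`** (and `= (i ∕ 3) · ρ Z_Kov`, `Z_Kov = E₀₀ + E₁₁ − 2 E₂₂`, when `ρ 1 = 0` — Kovačević's ★ `ρfun_one`);
* §3 **`kovLie ρ (X_{c E_p}) = c · ρ E_{a 2} + c̄ · ρ E_{2 a}`**, **`kovLie ρ (x_s) = e_k · ρ E_{a 2} + ē_k · ρ E_{2 a}`** (`x_s = upqPBasis s`, `s = ((a, 0), k)`,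
  `e₀ = (1+i)∕2`, `e₁ = (1−i)∕2`, ★ `upqPBasis`∕`upqPCoeff`), and the bracket **`kovLie ρ ⁅z₀, x_s⁆ = (i e_k) · ρ E_{a 2} + conj (i e_k) · ρ E_{2 a}`**
  (★ `lie_upqZ0_upqUnit`);
* §4 **`kovLie ρ W` for `W ∈ 𝔨`** (★ `upq_mem_kInLie_iff_blocks`: `W₁₂ = 0`, hence `W₂₁ = W₁₂ᴴ = 0`): the five-term expansion
  `Σ_{a,a′ ∈ {0,1}} W_{a a′} · ρ E_{a a′} + W_{22} · ρ E₂₂` — no `E_{a 2}`, `E_{2 a}` terms.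
With these, W4 of the line (the vertex value map `φ : 𝔤 → V_{2,3}`) reduces to Kovačević's ★ `lie_Z_vec` ∕ `B_eq_zero` ∕ `D_eq_zero` at the vertex
`(2, 3)` once that topic builds on the farm.

HC_CM is proved only modulo the 7 printed citations until rung 0 closes; this is ONE helper file of ONE floor-0 sub-line.

## References
* [Kovacevic2021] D. Kovačević, *the `(𝔤, K)`-modules of `SU(2,1)` from `K`-types* (2021) — §2–§3 (the basis `E_{ij}`, `Z`, the `K`-types).
* [BorelWallach2000] A. Borel, N. Wallach, *Continuous Cohomology, Discrete Subgroups, and Representations of Reductive Groups*, 2nd ed.,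
  AMS 2000 — II §4.1 (`z₀`, `ad z₀ = J` on `𝔭`), II §1.1 (5) (the frame of `𝔭`).
-/

set_option autoImplicit false
set_option linter.dupNamespace false

noncomputable section

open scoped ComplexConjugate Matrix

namespace Summit.HodgeConjecture.HodgeConjecture.Cruxes.H413.F0P3bU21Coordinates

open Literature.NumberTheory.Automorphic
open Literature.RepresentationTheory.BorelWallach2000
open Literature.RepresentationTheory.KonnoKonno2007 Literature.RepresentationTheory.KonnoKonno2007.RealDualPair
open Literature.RepresentationTheory.KonnoKonno2007.RealDualPair.UForm
open Summit.HodgeConjecture.HodgeConjecture.Cruxes.H413.F0P3bLocalAPacketsDefs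
open Summit.HodgeConjecture.HodgeConjecture.Cruxes.H413.F0P3bU21Restriction

-- Mathlib idiom (as in `GKModules`, the `Upq*` files, the defs leaf and the line): commutator bracket on `Module.End` ∕ matrices
attribute [local instance 100] LieRing.ofAssociativeRing

/-! ## §1 The reindex dictionary `Fin 2 ⊕ Fin 1 ≃ Fin 3` (the `β`-block last) -/

/-- `e⁻¹ 0 = inl 0` (private copy; the same three values are ★ in `F0P2aL2cOrderedProducts`, not imported here to keep
the P3b leaf closure free of P2a). [folklore] -/
private theorem finSumFinEquiv_symm_zero : (finSumFinEquiv : Fin 2 ⊕ Fin 1 ≃ Fin 3).symm 0 = Sum.inl 0 := by decide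

/-- `e⁻¹ 1 = inl 1` (private copy; the same three values are ★ in `F0P2aL2cOrderedProducts`, not imported here to keep
the P3b leaf closure free of P2a). [folklore] -/
private theorem finSumFinEquiv_symm_one : (finSumFinEquiv : Fin 2 ⊕ Fin 1 ≃ Fin 3).symm 1 = Sum.inl 1 := by decide

/-- `e⁻¹ 2 = inr 0` (the `β`-block is the last index) (private copy; the same three values are ★ in `F0P2aL2cOrderedProducts`, not imported here to keep
the P3b leaf closure free of P2a). [folklore] -/
private theorem finSumFinEquiv_symm_two : (finSumFinEquiv : Fin 2 ⊕ Fin 1 ≃ Fin 3).symm 2 = Sum.inr 0 := by decide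

/-- **`reindex z₀ = i (E₀₀ + E₁₁)`**: the matrix of `z₀ = [[i·1_α, 0], [0, 0_β]]` in `𝔤𝔩(3, ℂ)`. [cite: BorelWallach2000, II §4.1] -/
theorem reindex_z0 :
    Matrix.reindex (finSumFinEquiv : Fin 2 ⊕ Fin 1 ≃ Fin 3) (finSumFinEquiv : Fin 2 ⊕ Fin 1 ≃ Fin 3)
        (Matrix.fromBlocks (Complex.I • (1 : Matrix (Fin 2) (Fin 2) ℂ)) 0 0 (0 : Matrix (Fin 1) (Fin 1) ℂ)) =
      Complex.I • (Matrix.single 0 0 (1 : ℂ) + Matrix.single 1 1 1) := by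
  ext i j
  fin_cases i <;> fin_cases j <;>
    simp [Matrix.reindex_apply, Matrix.submatrix_apply, finSumFinEquiv_symm_zero, finSumFinEquiv_symm_one,
      finSumFinEquiv_symm_two]

/-- **`reindex X_{c E_(a,b)} = c E_{a 2} + c̄ E_{2 a}`**: the matrix `[[0, c E_{ab}], [(c E_{ab})ᴴ, 0]]` of the `𝔭`-direction `(a, b)`
(`b : Fin 1`) in `𝔤𝔩(3, ℂ)`. [cite: BorelWallach2000, II §1.1 (5)] -/
theorem reindex_unit (a : Fin 2) (b : Fin 1) (c : ℂ) :
    Matrix.reindex (finSumFinEquiv : Fin 2 ⊕ Fin 1 ≃ Fin 3) (finSumFinEquiv : Fin 2 ⊕ Fin 1 ≃ Fin 3)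
        (Matrix.fromBlocks 0 (Matrix.single a b c) (Matrix.single a b c)ᴴ 0) =
      c • Matrix.single (Fin.castSucc a) 2 (1 : ℂ) + conj c • Matrix.single 2 (Fin.castSucc a) (1 : ℂ) := by
  ext i j
  fin_cases a <;> fin_cases b <;> fin_cases i <;> fin_cases j <;>
    simp [Matrix.reindex_apply, Matrix.submatrix_apply, finSumFinEquiv_symm_zero, finSumFinEquiv_symm_one,
      finSumFinEquiv_symm_two]

/-- **`reindex [[A, 0], [0, D]] = Σ_{a a′} A a a′ E_{a a′} + D₀₀ E₂₂`** (block-diagonal matrices, i.e. `𝔨`, in `𝔤𝔩(3, ℂ)`). [cite: Kovacevic2021, §2] -/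
theorem reindex_blockDiagonal (A : Matrix (Fin 2) (Fin 2) ℂ) (D : Matrix (Fin 1) (Fin 1) ℂ) :
    Matrix.reindex (finSumFinEquiv : Fin 2 ⊕ Fin 1 ≃ Fin 3) (finSumFinEquiv : Fin 2 ⊕ Fin 1 ≃ Fin 3)
        (Matrix.fromBlocks A 0 0 D) =
      A 0 0 • Matrix.single 0 0 (1 : ℂ) + A 0 1 • Matrix.single 0 1 (1 : ℂ) + A 1 0 • Matrix.single 1 0 (1 : ℂ) +
        A 1 1 • Matrix.single 1 1 (1 : ℂ) + D 0 0 • Matrix.single 2 2 (1 : ℂ) := by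
  ext i j
  fin_cases i <;> fin_cases j <;>
    simp [Matrix.reindex_apply, Matrix.submatrix_apply, finSumFinEquiv_symm_zero, finSumFinEquiv_symm_one,
      finSumFinEquiv_symm_two]

/-! ## §2 `z₀` -/

variable {V : Type} [AddCommGroup V] [Module ℂ V] (ρ : Matrix (Fin 3) (Fin 3) ℂ →ₗ⁅ℂ⁆ Module.End ℂ V)

/-- `ρ (c E_{ij}) = c • ρ E_{ij}` (the matrix unit with coefficient). [folklore] -/
theorem map_single (i j : Fin 3) (c : ℂ) : ρ (Matrix.single i j c) = c • ρ (Matrix.single i j 1) := by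
  rw [show Matrix.single i j c = c • Matrix.single i j (1 : ℂ) by rw [Matrix.smul_single, smul_eq_mul, mul_one], map_smul]

/-- **`kovLie ρ z₀ = i · (ρ E₀₀ + ρ E₁₁)`**: the complex-structure element `z₀ = diag(i, i | 0)` of II §4.1 in Kovačević's coordinates.
[cite: BorelWallach2000, II §4.1] -/
theorem kovLie_upqZ0 :
    kovLie ρ (upqZ0 (Fin 2) (Fin 1)) = Complex.I • (ρ (Matrix.single 0 0 1) + ρ (Matrix.single 1 1 1)) := by
  rw [kovLie_apply, coe_upqZ0, reindex_z0, map_smul, map_add]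

/-- **`kovLie ρ z₀ = (i ∕ 3) · ρ Z_Kov`**, `Z_Kov = E₀₀ + E₁₁ − 2 E₂₂` (Kovačević's `Z`), for an action killing the identity (`ρ 1 = 0`, ★
`SU21Datum.ρfun_one`: the `𝔰𝔩(3)`-normalisation of an `SU21Datum`). [cite: Kovacevic2021, §3] -/
theorem kovLie_upqZ0_of_map_one (hρ1 : ρ 1 = 0) :
    kovLie ρ (upqZ0 (Fin 2) (Fin 1)) =
      (Complex.I / 3) • ρ (Matrix.single 0 0 1 + Matrix.single 1 1 1 - (2 : ℂ) • Matrix.single 2 2 1) := by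
  have h1 : (1 : Matrix (Fin 3) (Fin 3) ℂ) = Matrix.single 0 0 1 + Matrix.single 1 1 1 + Matrix.single 2 2 1 := by
    ext i j
    fin_cases i <;> fin_cases j <;> simp
  have h22 : ρ (Matrix.single 2 2 1) = -(ρ (Matrix.single 0 0 1) + ρ (Matrix.single 1 1 1)) := by
    rw [eq_neg_iff_add_eq_zero, add_comm, ← map_add, ← map_add, ← h1, hρ1]
  rw [kovLie_upqZ0, map_sub, map_smul, map_add, h22]
  module

/-! ## §3 The `𝔭`-frame and its `ad z₀`-image -/

/-- **`kovLie ρ (X_{c E_p}) = c · ρ E_{a 2} + c̄ · ρ E_{2 a}`** for the `𝔭`-direction `p = (a, 0)` (★ `upqUnit`). [cite: BorelWallach2000, II §1.1 (5)] -/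
theorem kovLie_upqUnit (p : Fin 2 × Fin 1) (c : ℂ) :
    kovLie ρ (upqUnit p c) =
      c • ρ (Matrix.single (Fin.castSucc p.1) 2 1) + conj c • ρ (Matrix.single 2 (Fin.castSucc p.1) 1) := by
  rw [kovLie_apply, coe_upqUnit, reindex_unit, map_add, map_smul, map_smul]

/-- **`kovLie ρ (x_s) = e_k · ρ E_{a 2} + ē_k · ρ E_{2 a}`** for the orthonormal `𝔭`-frame `x_s = upqPBasis s`, `s = ((a, 0), k)`,
`e_k = upqPCoeff k` (`e₀ = (1+i)∕2`, `e₁ = (1−i)∕2`). [cite: BorelWallach2000, II §1.1 (5)] -/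
theorem kovLie_upqPBasis (s : (Fin 2 × Fin 1) × Fin 2) :
    kovLie ρ (upqPBasis s) =
      upqPCoeff s.2 • ρ (Matrix.single (Fin.castSucc s.1.1) 2 1) +
        conj (upqPCoeff s.2) • ρ (Matrix.single 2 (Fin.castSucc s.1.1) 1) := by
  rw [upqPBasis, kovLie_upqUnit]

/-- **`kovLie ρ ⁅z₀, x_s⁆ = (i e_k) · ρ E_{a 2} + conj (i e_k) · ρ E_{2 a}`** (★ `lie_upqZ0_upqUnit`: `ad z₀` multiplies the `𝔭`-coefficient
by `i`). [cite: BorelWallach2000, II §4.1] -/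
theorem kovLie_lie_upqZ0_upqPBasis (s : (Fin 2 × Fin 1) × Fin 2) :
    kovLie ρ ⁅upqZ0 (Fin 2) (Fin 1), upqPBasis s⁆ =
      (Complex.I * upqPCoeff s.2) • ρ (Matrix.single (Fin.castSucc s.1.1) 2 1) +
        conj (Complex.I * upqPCoeff s.2) • ρ (Matrix.single 2 (Fin.castSucc s.1.1) 1) := by
  rw [upqPBasis, lie_upqZ0_upqUnit, kovLie_upqUnit]

/-- The same bracket as the commutator of the images (`kovLie ρ` is a Lie algebra morphism). [cite: BorelWallach2000, II §4.1] -/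
theorem kovLie_lie_upqZ0 (X : G21.lie) :
    kovLie ρ ⁅upqZ0 (Fin 2) (Fin 1), X⁆ = ⁅Complex.I • (ρ (Matrix.single 0 0 1) + ρ (Matrix.single 1 1 1)), kovLie ρ X⁆ := by
  rw [LieHom.map_lie, kovLie_upqZ0]

/-! ## §4 `𝔨 = 𝔲(2) ⊕ 𝔲(1)` -/

/-- The matrix of `W ∈ 𝔨` is block-diagonal: `W = [[W₁₁, 0], [0, W₂₂]]` (★ `upq_mem_kInLie_iff_blocks`: `W₁₂ = 0`, and `W₂₁ = W₁₂ᴴ`).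
[cite: BorelWallach2000, II §4.1] -/
theorem coe_eq_fromBlocks_of_mem_kInLie (W : G21.lie) (hW : W ∈ G21.kInLie) :
    (W : Matrix (Fin 2 ⊕ Fin 1) (Fin 2 ⊕ Fin 1) ℂ) =
      Matrix.fromBlocks (W : Matrix (Fin 2 ⊕ Fin 1) (Fin 2 ⊕ Fin 1) ℂ).toBlocks₁₁ 0 0
        (W : Matrix (Fin 2 ⊕ Fin 1) (Fin 2 ⊕ Fin 1) ℂ).toBlocks₂₂ := by
  have h12 := (upq_mem_kInLie_iff_blocks W).1 hW
  obtain ⟨-, -, h21⟩ := upq_lie_blocks W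
  conv_lhs => rw [← Matrix.fromBlocks_toBlocks (W : Matrix (Fin 2 ⊕ Fin 1) (Fin 2 ⊕ Fin 1) ℂ)]
  rw [h21, h12, Matrix.conjTranspose_zero]

/-- **`kovLie ρ W` for `W ∈ 𝔨`**: the five-term expansion `Σ_{a,a′ ∈ {0,1}} W_{a a′} · ρ E_{a a′} + W_{22} · ρ E₂₂` — `𝔨` acts
through the `E_{a a′}` (`a, a′ ≤ 1`) and `E₂₂` only (no `E_{a 2}`, `E_{2 a}`). [cite: Kovacevic2021, §2; BorelWallach2000, II §4.1] -/
theorem kovLie_of_mem_kInLie (W : G21.lie) (hW : W ∈ G21.kInLie) :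
    kovLie ρ W =
      (W : Matrix (Fin 2 ⊕ Fin 1) (Fin 2 ⊕ Fin 1) ℂ) (Sum.inl 0) (Sum.inl 0) • ρ (Matrix.single 0 0 1) +
      (W : Matrix (Fin 2 ⊕ Fin 1) (Fin 2 ⊕ Fin 1) ℂ) (Sum.inl 0) (Sum.inl 1) • ρ (Matrix.single 0 1 1) +
      (W : Matrix (Fin 2 ⊕ Fin 1) (Fin 2 ⊕ Fin 1) ℂ) (Sum.inl 1) (Sum.inl 0) • ρ (Matrix.single 1 0 1) +
      (W : Matrix (Fin 2 ⊕ Fin 1) (Fin 2 ⊕ Fin 1) ℂ) (Sum.inl 1) (Sum.inl 1) • ρ (Matrix.single 1 1 1) +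
      (W : Matrix (Fin 2 ⊕ Fin 1) (Fin 2 ⊕ Fin 1) ℂ) (Sum.inr 0) (Sum.inr 0) • ρ (Matrix.single 2 2 1) := by
  have hre : Matrix.reindex (finSumFinEquiv : Fin 2 ⊕ Fin 1 ≃ Fin 3) (finSumFinEquiv : Fin 2 ⊕ Fin 1 ≃ Fin 3)
      (W : Matrix (Fin 2 ⊕ Fin 1) (Fin 2 ⊕ Fin 1) ℂ) =
      (W : Matrix (Fin 2 ⊕ Fin 1) (Fin 2 ⊕ Fin 1) ℂ) (Sum.inl 0) (Sum.inl 0) • Matrix.single 0 0 (1 : ℂ) +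
      (W : Matrix (Fin 2 ⊕ Fin 1) (Fin 2 ⊕ Fin 1) ℂ) (Sum.inl 0) (Sum.inl 1) • Matrix.single 0 1 (1 : ℂ) +
      (W : Matrix (Fin 2 ⊕ Fin 1) (Fin 2 ⊕ Fin 1) ℂ) (Sum.inl 1) (Sum.inl 0) • Matrix.single 1 0 (1 : ℂ) +
      (W : Matrix (Fin 2 ⊕ Fin 1) (Fin 2 ⊕ Fin 1) ℂ) (Sum.inl 1) (Sum.inl 1) • Matrix.single 1 1 (1 : ℂ) +
      (W : Matrix (Fin 2 ⊕ Fin 1) (Fin 2 ⊕ Fin 1) ℂ) (Sum.inr 0) (Sum.inr 0) • Matrix.single 2 2 (1 : ℂ) := by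
    conv_lhs => rw [coe_eq_fromBlocks_of_mem_kInLie W hW]
    rw [reindex_blockDiagonal]
    rfl
  rw [kovLie_apply, hre, map_add, map_add, map_add, map_add, map_smul, map_smul, map_smul, map_smul, map_smul]

end Summit.HodgeConjecture.HodgeConjecture.Cruxes.H413.F0P3bU21Coordinates
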